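import Literature.NumberTheory.LFunctions.ZetaZeroFreeRegion
import Literature.NumberTheory.LFunctions.ZetaRealAxis
import Mathlib.Analysis.ODE.Gronwall
import Mathlib.NumberTheory.LSeries.Dirichlet
import HarnessLib

/-!
# `ζ`, `1/ζ`, `ζ'/ζ` in the classical zero-free region (Titchmarsh (3.11.7)–(3.11.8), GPY (5.4))

Topic `Literature/NumberTheory/LFunctions`. Everything in this file is PROVED. It supplies, in the
exact shape used by Goldston–Pintz–Yıldırım, *Primes in tuples I* (Ann. of Math. 170 (2009)), §5,
(5.3)–(5.4) — the analytic input of their Lemma 3 (the contour `ℒ : s = −c̄/log(|t|+3) + it` of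
(5.5) and the residue computations of §§6–8) — the standard information on `ζ` near `σ = 1`:

* `Literature.NumberTheory.LFunctions.ZetaClassicalRegion.exists_zeroFreeRegion_bounds` — there are `0 < c̄ ≤ 10⁻²` and `C > 0`
  such that for all `s = σ + it ≠ 1` with `σ ≥ 1 − 4c̄/log(|t|+3)`:
  `ζ(s) ≠ 0`, `‖ζ(s) − 1/(s−1)‖ ≤ C log(|t|+3)`, `‖1/ζ(s)‖ ≤ C log(|t|+3)`,
  `‖ζ'/ζ(s) + 1/(s−1)‖ ≤ C log(|t|+3)`
  (GPY (5.3)–(5.4) = Titchmarsh, Theorem 3.11, (3.11.7)–(3.11.8), in a region `σ ≥ 1 − A/log t`).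

## Proof (all inputs are in the tree or Mathlib)

* zero-freeness and `ζ'/ζ + 1/(s−1) = ζ₁'/ζ₁ ≪ log(|t|+4)` (`ζ₁ = (s−1)ζ` entire): the de la Vallée
  Poussin–Landau argument `Literature.NumberTheory.LFunctions.ClassicalZFRData.zeroFree` / `.norm_logDeriv_le` specialised to `ζ`
  (`Literature.NumberTheory.LFunctions.classicalZFRData_riemannZeta`, `ZetaZeroFreeRegion.lean`; Montgomery–Vaughan Theorems
  6.6–6.7); GPY's region with `c̄ = min(c₀/8, 10⁻²)` sits inside it (`region_dlvp`);
* `ζ(s) − 1/(s−1) ≪ log(|t|+3)`: Titchmarsh's Theorem 3.5 for `|t| ≥ 3`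
  (`Literature.NumberTheory.LFunctions.ZetaOneLine.norm_riemannZeta_le_log`), the entire `riemannZeta₀` on the compact rectangle
  `[1/2, 2] × [−3, 3]`, and `‖ζ(s)‖ ≤ σ/(σ−1) ≤ 2` for `σ > 2`;
* `1/ζ(s) ≪ log(|t|+3)`: `‖1/ζ(s)‖ = ‖L(μ, s)‖ ≤ σ/(σ−1)` right of `σ₀ = 1 + 1/log(|t|+3)`; the
  continuous `(s−1)/ζ₁(s)` on a compact rectangle inside the zero-free region for `|t| ≤ 3`; and for
  `|t| ≥ 3`, `σ ≤ σ₀`, Titchmarsh's integration of `ζ'/ζ` along the horizontal segment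
  `[σ, σ₀] + it` ((3.11.6)–(3.11.8)), done here with Grönwall's inequality
  (`norm_le_gronwallBound_of_norm_deriv_right_le`) and the lower bound `‖ζ(σ₀+it)‖ ≥ (σ₀−1)/σ₀`.
(`1 < log 3` is the tree's `Literature.NumberTheory.LFunctions.MertensBound.one_lt_log_three`.)

## References

* D. A. Goldston, J. Pintz, C. Y. Yıldırım, *Primes in tuples. I*, Ann. of Math. (2) 170 (2009),
  819–862 = arXiv:math/0508185, §5, (5.2)–(5.5), p. 11. [cite: GoldstonPintzYildirim2009]
* E. C. Titchmarsh, *The Theory of the Riemann Zeta-Function*, 2nd ed. (rev. D. R. Heath-Brown),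
  Oxford 1986, §3.5 Theorem 3.5; §3.11 Theorem 3.11, (3.11.6)–(3.11.8) (p. 57).
  [cite: Titchmarsh1986]
* H. L. Montgomery, R. C. Vaughan, *Multiplicative Number Theory I*, CUP 2007, Theorems 6.6–6.7.
  [cite: MontgomeryVaughan2007]
-/

noncomputable section

open Complex Set Filter Topology

namespace Literature.NumberTheory.LFunctions.ZetaClassicalRegion

/-- For real `σ > 1`, `ζ(σ) ≤ σ/(σ − 1)`, read off Titchmarsh's (2.1.4)
`ζ(σ) = σ/(σ−1) − σ ∫_1^∞ {x} x^{−σ−1} dx` (the tree's `Literature.NumberTheory.LFunctions.riemannZeta_ofReal_eq_of_pos`).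
[cite: Titchmarsh1986, §2.1 eq. (2.1.4)] -/
theorem riemannZeta_ofReal_re_le {σ : ℝ} (hσ : 1 < σ) : (riemannZeta σ).re ≤ σ / (σ - 1) := by
  have h := Literature.NumberTheory.LFunctions.riemannZeta_ofReal_eq_of_pos (zero_lt_one.trans hσ) hσ.ne'
  rw [h, Complex.ofReal_re]
  have hI := Literature.NumberTheory.LFunctions.fractIntegralReal_nonneg σ
  have hσ0 : 0 < σ := zero_lt_one.trans hσ
  nlinarith

/-- `‖L(f, s)‖ ≤ σ/(σ − 1)` for coefficients `‖f(n)‖ ≤ 1` and `σ = re s > 1` (termwise comparison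
with `ζ(σ) = ∑ n^{−σ}`). [folklore] -/
theorem norm_LSeries_le_of_norm_le_one {f : ℕ → ℂ} (hf : ∀ n, ‖f n‖ ≤ 1) {s : ℂ}
    (hs : 1 < s.re) : ‖LSeries f s‖ ≤ s.re / (s.re - 1) := by
  set σ : ℝ := s.re with hσdef
  have hsum1 : LSeriesSummable 1 (σ : ℂ) := LSeriesSummable_one_iff.2 (by simp [hs])
  have hterm : ∀ n, ‖LSeries.term f s n‖ ≤ ‖LSeries.term 1 (σ : ℂ) n‖ := by
    intro n
    rcases eq_or_ne n 0 with rfl | hn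
    · simp
    rw [LSeries.norm_term_eq, LSeries.norm_term_eq, if_neg hn, if_neg hn]
    simp only [Pi.one_apply, norm_one, Complex.ofReal_re]
    exact div_le_div_of_nonneg_right (hf n) (by positivity)
  have hsumf : Summable fun n => ‖LSeries.term f s n‖ :=
    Summable.of_nonneg_of_le (fun n => norm_nonneg _) hterm hsum1.norm
  have h2 : ∀ n, ‖LSeries.term 1 (σ : ℂ) n‖ = (LSeries.term 1 (σ : ℂ) n).re := by
    intro n
    rcases eq_or_ne n 0 with rfl | hn
    · simp
    rw [LSeries.norm_term_eq, if_neg hn, LSeries.term_of_ne_zero hn]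
    simp only [Pi.one_apply, norm_one, Complex.ofReal_re]
    have : (n : ℂ) ^ (σ : ℂ) = ((n : ℝ) ^ σ : ℝ) := by
      rw [Complex.ofReal_cpow (Nat.cast_nonneg n)]; simp
    rw [this, show (1 : ℂ) = ((1 : ℝ) : ℂ) from rfl, ← Complex.ofReal_div, Complex.ofReal_re]
  have h3 : (LSeries 1 (σ : ℂ)).re = ∑' n, (LSeries.term 1 (σ : ℂ) n).re := by
    rw [LSeries, Complex.re_tsum hsum1]
  calc ‖LSeries f s‖ ≤ ∑' n, ‖LSeries.term f s n‖ := norm_tsum_le_tsum_norm hsumf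
    _ ≤ ∑' n, ‖LSeries.term 1 (σ : ℂ) n‖ := Summable.tsum_le_tsum hterm hsumf hsum1.norm
    _ = ∑' n, (LSeries.term 1 (σ : ℂ) n).re := tsum_congr h2
    _ = (LSeries 1 (σ : ℂ)).re := h3.symm
    _ = (riemannZeta σ).re := by rw [LSeries_one_eq_riemannZeta (by simp [hs])]
    _ ≤ σ / (σ - 1) := riemannZeta_ofReal_re_le hs

/-- `‖ζ(s)‖ ≤ σ/(σ − 1)` for `σ = re s > 1`. [folklore] -/
theorem norm_riemannZeta_le_of_one_lt_re {s : ℂ} (hs : 1 < s.re) :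
    ‖riemannZeta s‖ ≤ s.re / (s.re - 1) := by
  rw [← LSeries_one_eq_riemannZeta hs]
  exact norm_LSeries_le_of_norm_le_one (fun n => by simp) hs

/-- `‖1/ζ(s)‖ ≤ σ/(σ − 1)` for `σ = re s > 1`, since `1/ζ(s) = L(μ, s)` (Mathlib's
`LSeries_one_mul_Lseries_moebius`) and `|μ| ≤ 1`. [cite: Titchmarsh1986, §1.1 eq. (1.1.4)] -/
theorem norm_inv_riemannZeta_le_of_one_lt_re {s : ℂ} (hs : 1 < s.re) :
    ‖(riemannZeta s)⁻¹‖ ≤ s.re / (s.re - 1) := by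
  have h := LSeries_one_mul_Lseries_moebius hs
  rw [LSeries_one_eq_riemannZeta hs] at h
  rw [(inv_eq_of_mul_eq_one_right h :
    (riemannZeta s)⁻¹ = LSeries (fun n => (ArithmeticFunction.moebius n : ℂ)) s)]
  refine norm_LSeries_le_of_norm_le_one (fun n => ?_) hs
  rw [Complex.norm_intCast]
  exact_mod_cast ArithmeticFunction.abs_moebius_le_one

/-- `‖ζ(s)‖ ≥ (σ − 1)/σ` for `σ = re s > 1` (the reciprocal of the previous bound). [folklore] -/
theorem norm_riemannZeta_ge_of_one_lt_re {s : ℂ} (hs : 1 < s.re) :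
    (s.re - 1) / s.re ≤ ‖riemannZeta s‖ := by
  have hζ : riemannZeta s ≠ 0 := riemannZeta_ne_zero_of_one_lt_re hs
  have h := norm_inv_riemannZeta_le_of_one_lt_re hs
  rw [norm_inv] at h
  have hpos : 0 < ‖riemannZeta s‖ := norm_pos_iff.2 hζ
  have hσ1 : 0 < s.re - 1 := by linarith
  rw [div_le_iff₀ (by linarith)]
  rw [inv_le_iff_one_le_mul₀ hpos] at h
  -- h : 1 ≤ (s.re / (s.re - 1)) * ‖ζ s‖
  rw [div_mul_eq_mul_div, le_div_iff₀ hσ1] at h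
  linarith

/-! ### Elementary inequalities for `L = log(|t| + 3)` -/

/-- `1 < log(|t| + 3)`. [folklore] -/
theorem one_lt_log_abs_add_three (t : ℝ) : 1 < Real.log (|t| + 3) :=
  MertensBound.one_lt_log_three.trans_le
    (Real.log_le_log (by norm_num) (by linarith [abs_nonneg t]))

/-- `log(|t| + 4) ≤ 2 log(|t| + 3)` (`|t| + 4 ≤ (|t| + 3)²`): Montgomery–Vaughan's `log(|t|+4)`
versus GPY's `log(|t|+3)`. [folklore] -/
theorem log_abs_add_four_le (t : ℝ) : Real.log (|t| + 4) ≤ 2 * Real.log (|t| + 3) := by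
  have h : |t| + 4 ≤ (|t| + 3) ^ 2 := by nlinarith [abs_nonneg t]
  calc Real.log (|t| + 4) ≤ Real.log ((|t| + 3) ^ 2) :=
        Real.log_le_log (by positivity) h
    _ = 2 * Real.log (|t| + 3) := by rw [Real.log_pow]; norm_num

/-- GPY's region `σ ≥ 1 − 4c̄/log(|t|+3)` with `c̄ ≤ min(c₀/8, 10⁻²)` lies inside the de la Vallée
Poussin region `σ ≥ 1 − c₀/log(|t|+4)`, `σ > 1/2` of the tree's `Literature.NumberTheory.LFunctions.ClassicalZFRData.zeroFree`.
[folklore] -/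
theorem region_dlvp {c₀ cbar σ t : ℝ} (hcb0 : 0 ≤ cbar) (hcb : cbar ≤ c₀ / 8)
    (hcb1 : cbar ≤ 1 / 100) (hσ : 1 - 4 * cbar / Real.log (|t| + 3) ≤ σ) :
    1 - c₀ / Real.log (|t| + 4) ≤ σ ∧ 1 / 2 < σ := by
  have hL3 := one_lt_log_abs_add_three t
  have hL4 : 0 < Real.log (|t| + 4) := Real.log_pos (by linarith [abs_nonneg t])
  have h44 := log_abs_add_four_le t
  constructor
  · have : 4 * cbar / Real.log (|t| + 3) ≤ c₀ / Real.log (|t| + 4) := by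
      rw [div_le_div_iff₀ (by linarith) hL4]
      nlinarith
    linarith
  · have : 4 * cbar / Real.log (|t| + 3) ≤ 4 * cbar := div_le_self (by linarith) hL3.le
    linarith

/-- For `|t| ≥ 3`, GPY's region (`c̄ ≤ 10⁻²`) lies inside Titchmarsh's `σ ≥ 1 − 1/(2 log|t|)` of
Theorem 3.5 (the tree's `Literature.NumberTheory.LFunctions.ZetaOneLine.norm_riemannZeta_le_log`). [folklore] -/
theorem region_oneLine {cbar σ t : ℝ} (hcb1 : cbar ≤ 1 / 100) (ht : 3 ≤ |t|)
    (hσ : 1 - 4 * cbar / Real.log (|t| + 3) ≤ σ) : 1 - 1 / (2 * Real.log |t|) ≤ σ := by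
  have hlt : 1 < Real.log |t| :=
    MertensBound.one_lt_log_three.trans_le (Real.log_le_log (by norm_num) ht)
  have hle : Real.log |t| ≤ Real.log (|t| + 3) := Real.log_le_log (by linarith) (by linarith)
  have : 4 * cbar / Real.log (|t| + 3) ≤ 1 / (2 * Real.log |t|) := by
    rw [div_le_div_iff₀ (by linarith) (by linarith)]
    nlinarith
  linarith

/-! ### (5.3) and the third bound of (5.4): zero-freeness and `ζ'/ζ + 1/(s−1) ≪ log(|t|+3)` -/

/-- GPY (5.3) and the third bound of (5.4) relative to the constants `c₀, C₀` of the tree's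
log-derivative bound for `ζ₁ = (s−1)ζ` (`Literature.NumberTheory.LFunctions.ClassicalZFRData.norm_logDeriv_le`,
Montgomery–Vaughan Theorem 6.7): in the region `σ ≥ 1 − 4c̄/log(|t|+3)`, `c̄ ≤ min(c₀/8, 10⁻²)`,
`s ≠ 1`: `ζ(s) ≠ 0` and `‖ζ'/ζ(s) + 1/(s−1)‖ = ‖ζ₁'/ζ₁(s)‖ ≤ 2C₀ log(|t|+3)`.
[cite: GoldstonPintzYildirim2009, Section 5 eq. 5.3 and 5.4] -/
theorem ne_zero_and_norm_logDeriv_add_le {c₀ C₀ cbar : ℝ} (hC₀ : 0 ≤ C₀)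
    (hreg : ∀ s : ℂ, 1 / 2 < s.re → 1 - c₀ / Real.log (|s.im| + 4) ≤ s.re →
      riemannZeta₁ s ≠ 0 ∧ ‖deriv riemannZeta₁ s / riemannZeta₁ s‖ ≤ C₀ * Real.log (|s.im| + 4))
    (hcb0 : 0 ≤ cbar) (hcb : cbar ≤ c₀ / 8) (hcb1 : cbar ≤ 1 / 100) {s : ℂ} (hs1 : s ≠ 1)
    (hσ : 1 - 4 * cbar / Real.log (|s.im| + 3) ≤ s.re) :
    riemannZeta s ≠ 0 ∧
      ‖deriv riemannZeta s / riemannZeta s + 1 / (s - 1)‖ ≤ 2 * C₀ * Real.log (|s.im| + 3) := by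
  obtain ⟨h1, h2⟩ := region_dlvp hcb0 hcb hcb1 hσ
  obtain ⟨hne₁, hbd⟩ := hreg s h2 h1
  have hζ : riemannZeta s ≠ 0 := fun h => hne₁ ((Literature.NumberTheory.LFunctions.riemannZeta₁_eq_zero_iff hs1).2 h)
  refine ⟨hζ, ?_⟩
  have heq : deriv riemannZeta s / riemannZeta s + 1 / (s - 1) =
      deriv riemannZeta₁ s / riemannZeta₁ s := by
    have := Literature.NumberTheory.LFunctions.logDeriv_riemannZeta_eq hs1 hζ
    rw [logDeriv_apply, logDeriv_apply] at this
    rw [this, one_div]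
    ring
  rw [heq]
  calc ‖deriv riemannZeta₁ s / riemannZeta₁ s‖ ≤ C₀ * Real.log (|s.im| + 4) := hbd
    _ ≤ C₀ * (2 * Real.log (|s.im| + 3)) :=
        mul_le_mul_of_nonneg_left (log_abs_add_four_le _) hC₀
    _ = 2 * C₀ * Real.log (|s.im| + 3) := by ring

/-! ### The first bound of (5.4): `ζ(s) − 1/(s−1) ≪ log(|t|+3)` -/

/-- First bound of (5.4) for `|t| ≥ 3`: `‖ζ(s) − 1/(s−1)‖ ≤ 21 log|t| + 1 ≤ 22 log(|t|+3)` in GPY's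
region (Titchmarsh's Theorem 3.5, `ζ(s) = O(log t)` for `σ ≥ 1 − 1/(2 log t)`, the tree's
`Literature.NumberTheory.LFunctions.ZetaOneLine.norm_riemannZeta_le_log`). [cite: Titchmarsh1986, Theorem 3.5 eq. (3.5.1)] -/
theorem norm_sub_inv_le_of_three_le {cbar : ℝ} (hcb1 : cbar ≤ 1 / 100) {s : ℂ}
    (ht : 3 ≤ |s.im|) (hσ : 1 - 4 * cbar / Real.log (|s.im| + 3) ≤ s.re) :
    ‖riemannZeta s - 1 / (s - 1)‖ ≤ 22 * Real.log (|s.im| + 3) := by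
  have hreg := region_oneLine hcb1 ht hσ
  have hζ := Literature.NumberTheory.LFunctions.ZetaOneLine.norm_riemannZeta_le_log ht hreg
  have hlogt : Real.log |s.im| ≤ Real.log (|s.im| + 3) :=
    Real.log_le_log (by linarith) (by linarith)
  have hL3 := one_lt_log_abs_add_three s.im
  have him : |s.im| ≤ ‖s - 1‖ := by simpa using Complex.abs_im_le_norm (s - 1)
  have hinv : ‖1 / (s - 1)‖ ≤ 1 := by
    rw [norm_div, norm_one, div_le_one (by linarith)]
    linarith
  have h21 : 0 ≤ Real.log |s.im| := by
    linarith [MertensBound.one_lt_log_three, Real.log_le_log (by norm_num) ht]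
  calc ‖riemannZeta s - 1 / (s - 1)‖ ≤ ‖riemannZeta s‖ + ‖1 / (s - 1)‖ := norm_sub_le _ _
    _ ≤ 21 * Real.log |s.im| + 1 := add_le_add hζ hinv
    _ ≤ 22 * Real.log (|s.im| + 3) := by nlinarith

/-- First bound of (5.4) near the pole: `ζ(s) − 1/(s−1)` is bounded on `1/2 ≤ σ ≤ 2`, `|t| ≤ 3`
(`s ≠ 1`), being Mathlib's entire `riemannZeta₀` there, continuous on the compact rectangle (same
argument as `Literature.Pretentious`'s bound on `[1, 2] × [−2, 2]` in `PretentiousZeta.lean`).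
[cite: Titchmarsh1986, §2.1 eq. (2.1.16)] -/
theorem exists_bound_sub_inv_rect :
    ∃ M : ℝ, 0 ≤ M ∧ ∀ s : ℂ, 1 / 2 ≤ s.re → s.re ≤ 2 → |s.im| ≤ 3 → s ≠ 1 →
      ‖riemannZeta s - 1 / (s - 1)‖ ≤ M := by
  obtain ⟨M, hM⟩ := (IsCompact.reProdIm isCompact_Icc isCompact_Icc :
      IsCompact (Set.Icc (1 / 2 : ℝ) 2 ×ℂ Set.Icc (-3 : ℝ) 3)).exists_bound_of_continuousOn
    differentiable_riemannZeta₀.continuous.continuousOn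
  refine ⟨max M 0, le_max_right _ _, fun s h1 h2 h3 hs => ?_⟩
  rw [one_div, riemannZeta_eq_inv_sub_add hs, add_sub_cancel_left]
  exact (hM s ⟨⟨h1, h2⟩, abs_le.1 h3⟩).trans (le_max_left _ _)

/-- First bound of (5.4) for `σ > 2`: `‖ζ(s) − 1/(s−1)‖ ≤ 2 + 1`. [folklore] -/
theorem norm_sub_inv_le_of_two_lt_re {s : ℂ} (hs : 2 < s.re) :
    ‖riemannZeta s - 1 / (s - 1)‖ ≤ 3 := by
  have h1 : ‖riemannZeta s‖ ≤ 2 := by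
    refine (norm_riemannZeta_le_of_one_lt_re (by linarith)).trans ?_
    rw [div_le_iff₀ (by linarith)]
    linarith
  have hs1 : s ≠ 1 := by
    rintro rfl
    simp at hs
  have hre : s.re - 1 ≤ ‖s - 1‖ := by
    have := Complex.re_le_norm (s - 1)
    simpa using this
  have h2 : ‖1 / (s - 1)‖ ≤ 1 := by
    rw [norm_div, norm_one, div_le_one (norm_pos_iff.2 (sub_ne_zero.2 hs1))]
    linarith
  calc ‖riemannZeta s - 1 / (s - 1)‖ ≤ ‖riemannZeta s‖ + ‖1 / (s - 1)‖ := norm_sub_le _ _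
    _ ≤ 3 := by linarith

/-! ### The second bound of (5.4): `1/ζ(s) ≪ log(|t|+3)` -/

/-- Second bound of (5.4) to the right of `σ₀ = 1 + 1/L`: `‖1/ζ(s)‖ ≤ σ/(σ−1) ≤ 1 + L`
(Titchmarsh p. 57: "for larger `σ` it is trivial").
[cite: Titchmarsh1986, Theorem 3.11 eq. (3.11.8)] -/
theorem norm_inv_le_of_re_ge {s : ℂ} {L : ℝ} (hL : 0 < L) (hσ : 1 + 1 / L ≤ s.re) :
    ‖(riemannZeta s)⁻¹‖ ≤ 1 + L := by
  have hL' : 0 < 1 / L := one_div_pos.2 hL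
  have hs : 1 < s.re := by linarith
  have hne : s.re - 1 ≠ 0 := ne_of_gt (by linarith)
  calc ‖(riemannZeta s)⁻¹‖ ≤ s.re / (s.re - 1) := norm_inv_riemannZeta_le_of_one_lt_re hs
    _ = 1 + 1 / (s.re - 1) := by field_simp; ring
    _ ≤ 1 + 1 / (1 / L) := by
        gcongr
        linarith
    _ = 1 + L := by rw [one_div_one_div]

/-- Second bound of (5.4) near the pole: `1/ζ(s) = (s−1)/ζ₁(s)` is bounded on
`1 − 4c̄/log 3 ≤ σ ≤ 2`, `|t| ≤ 3`, `s ≠ 1`, a compact rectangle inside the zero-free region of the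
entire `ζ₁` (`c̄ ≤ c₀/8` and `log 7 ≤ 2 log 3`).
[cite: Titchmarsh1986, Theorem 3.11 eq. (3.11.8)] -/
theorem exists_bound_inv_rect {c₀ C₀ cbar : ℝ}
    (hreg : ∀ s : ℂ, 1 / 2 < s.re → 1 - c₀ / Real.log (|s.im| + 4) ≤ s.re →
      riemannZeta₁ s ≠ 0 ∧ ‖deriv riemannZeta₁ s / riemannZeta₁ s‖ ≤ C₀ * Real.log (|s.im| + 4))
    (hcb0 : 0 ≤ cbar) (hcb : cbar ≤ c₀ / 8) (hcb1 : cbar ≤ 1 / 100) :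
    ∃ M : ℝ, 0 ≤ M ∧ ∀ s : ℂ, 1 - 4 * cbar / Real.log 3 ≤ s.re → s.re ≤ 2 → |s.im| ≤ 3 →
      s ≠ 1 → ‖(riemannZeta s)⁻¹‖ ≤ M := by
  set K : Set ℂ := Set.Icc (1 - 4 * cbar / Real.log 3) 2 ×ℂ Set.Icc (-3 : ℝ) 3 with hKdef
  have hK : IsCompact K := IsCompact.reProdIm isCompact_Icc isCompact_Icc
  have hl3 := MertensBound.one_lt_log_three
  have hne : ∀ z ∈ K, riemannZeta₁ z ≠ 0 := by
    intro z hz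
    rw [hKdef, Complex.mem_reProdIm, Set.mem_Icc, Set.mem_Icc] at hz
    refine (hreg z ?_ ?_).1
    · have : 4 * cbar / Real.log 3 ≤ 4 * cbar := div_le_self (by linarith) hl3.le
      linarith [hz.1.1]
    · have him : |z.im| ≤ 3 := abs_le.2 hz.2
      have hL4 : 0 < Real.log (|z.im| + 4) := Real.log_pos (by linarith [abs_nonneg z.im])
      have h7 : Real.log (|z.im| + 4) ≤ 2 * Real.log 3 := by
        calc Real.log (|z.im| + 4) ≤ Real.log ((3 : ℝ) ^ 2) :=
              Real.log_le_log (by linarith [abs_nonneg z.im]) (by nlinarith)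
          _ = 2 * Real.log 3 := by rw [Real.log_pow]; norm_num
      have : 4 * cbar / Real.log 3 ≤ c₀ / Real.log (|z.im| + 4) := by
        rw [div_le_div_iff₀ (by linarith) hL4]
        nlinarith
      linarith [hz.1.1]
  have hcont : ContinuousOn (fun z : ℂ => (z - 1) / riemannZeta₁ z) K :=
    ContinuousOn.div (by fun_prop) differentiable_riemannZeta₁.continuous.continuousOn hne
  obtain ⟨M, hM⟩ := hK.exists_bound_of_continuousOn hcont
  refine ⟨max M 0, le_max_right _ _, fun s h1 h2 h3 hs1 => ?_⟩
  have hmem : s ∈ K := by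
    rw [hKdef, Complex.mem_reProdIm]
    exact ⟨⟨h1, h2⟩, abs_le.1 h3⟩
  have h := hM s hmem
  rw [Literature.NumberTheory.LFunctions.riemannZeta₁_eq_mul hs1, ← div_div, div_self (sub_ne_zero.2 hs1), one_div] at h
  exact h.trans (le_max_left _ _)

/-- Second bound of (5.4) for `|t| ≥ 3`, `σ ≤ σ₀ = 1 + 1/L`, `L = log(|t|+3)` — Titchmarsh's
integration of `ζ'/ζ` along `[σ, σ₀] + it` ((3.11.6)–(3.11.8), p. 57), here as Grönwall's
inequality: from `‖ζ'‖ ≤ (2C₀+1) L ‖ζ‖` on the segment, `‖ζ(σ₀+it)‖ ≤ ‖ζ(σ+it)‖ e^{(2C₀+1)(1+4c̄)}`, while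
`‖ζ(σ₀+it)‖ ≥ (σ₀−1)/σ₀ ≥ 1/(2L)`; hence `‖1/ζ(σ+it)‖ ≤ 2e^{2(2C₀+1)} L`.
[cite: Titchmarsh1986, Theorem 3.11 eq. (3.11.6) to (3.11.8)] -/
theorem norm_inv_le_of_three_le {c₀ C₀ cbar : ℝ} (hC₀ : 0 ≤ C₀)
    (hreg : ∀ s : ℂ, 1 / 2 < s.re → 1 - c₀ / Real.log (|s.im| + 4) ≤ s.re →
      riemannZeta₁ s ≠ 0 ∧ ‖deriv riemannZeta₁ s / riemannZeta₁ s‖ ≤ C₀ * Real.log (|s.im| + 4))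
    (hcb0 : 0 ≤ cbar) (hcb : cbar ≤ c₀ / 8) (hcb1 : cbar ≤ 1 / 100) {σ t : ℝ} (ht : 3 ≤ |t|)
    (hσ : 1 - 4 * cbar / Real.log (|t| + 3) ≤ σ) (hσ0 : σ ≤ 1 + 1 / Real.log (|t| + 3)) :
    ‖(riemannZeta (σ + I * t))⁻¹‖ ≤
      2 * Real.exp (2 * (2 * C₀ + 1)) * Real.log (|t| + 3) := by
  set L : ℝ := Real.log (|t| + 3) with hLdef
  have hL1 : 1 < L := one_lt_log_abs_add_three t
  have hL0 : 0 < L := by linarith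
  set σ₀ : ℝ := 1 + 1 / L with hσ₀def
  set K : ℝ := (2 * C₀ + 1) * L with hKdef
  have hK0 : 0 ≤ K := by positivity
  have ht0 : t ≠ 0 := by
    intro h
    rw [h, abs_zero] at ht
    norm_num at ht
  set f : ℝ → ℂ := fun u => riemannZeta (u + I * t) with hfdef
  -- pointwise facts on the half-line `σ ≤ x` at height `t`
  have hpt : ∀ x : ℝ, σ ≤ x → riemannZeta (x + I * t) ≠ 0 ∧
      ‖deriv riemannZeta (x + I * t)‖ ≤ K * ‖riemannZeta (x + I * t)‖ := by
    intro x hx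
    have hre : ((x : ℂ) + I * t).re = x := by simp
    have him : ((x : ℂ) + I * t).im = t := by simp
    have hs1 : ((x : ℂ) + I * t) ≠ 1 := by
      intro h
      have := congrArg Complex.im h
      rw [him] at this
      simp at this
      exact ht0 this
    have hσ' : 1 - 4 * cbar / Real.log (|((x : ℂ) + I * t).im| + 3) ≤ ((x : ℂ) + I * t).re := by
      rw [hre, him]
      exact hσ.trans hx
    obtain ⟨hζ, hbd⟩ := ne_zero_and_norm_logDeriv_add_le hC₀ hreg hcb0 hcb hcb1 hs1 hσ'
    rw [him] at hbd
    refine ⟨hζ, ?_⟩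
    have himn : |t| ≤ ‖(x : ℂ) + I * t - 1‖ := by
      have := Complex.abs_im_le_norm ((x : ℂ) + I * t - 1)
      simpa using this
    have hinv : ‖1 / ((x : ℂ) + I * t - 1)‖ ≤ 1 := by
      rw [norm_div, norm_one, div_le_one (by linarith)]
      linarith
    have hq : ‖deriv riemannZeta (x + I * t) / riemannZeta (x + I * t)‖ ≤ K := by
      have hsplit : deriv riemannZeta (x + I * t) / riemannZeta (x + I * t) =
          (deriv riemannZeta (x + I * t) / riemannZeta (x + I * t) + 1 / ((x : ℂ) + I * t - 1)) -
            1 / ((x : ℂ) + I * t - 1) := by ring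
      rw [hsplit]
      calc _ ≤ ‖deriv riemannZeta (x + I * t) / riemannZeta (x + I * t) +
              1 / ((x : ℂ) + I * t - 1)‖ + ‖1 / ((x : ℂ) + I * t - 1)‖ := norm_sub_le _ _
        _ ≤ 2 * C₀ * L + 1 := add_le_add hbd hinv
        _ ≤ K := by rw [hKdef]; nlinarith
    calc ‖deriv riemannZeta (x + I * t)‖ =
        ‖deriv riemannZeta (x + I * t) / riemannZeta (x + I * t)‖ * ‖riemannZeta (x + I * t)‖ := by
          rw [← norm_mul, div_mul_cancel₀ _ hζ]
      _ ≤ K * ‖riemannZeta (x + I * t)‖ := mul_le_mul_of_nonneg_right hq (norm_nonneg _)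
  -- Grönwall on `[σ, σ₀]`
  have hσσ₀ : σ ≤ σ₀ := hσ0
  have hderiv : ∀ x : ℝ, HasDerivAt f (deriv riemannZeta (x + I * t)) x := fun x =>
    Literature.NumberTheory.LFunctions.ZetaOneLine.hasDerivAt_riemannZeta_horizontal ht0 x
  have hcont : ContinuousOn f (Set.Icc σ σ₀) := fun x _ =>
    (hderiv x).continuousAt.continuousWithinAt
  have hG := norm_le_gronwallBound_of_norm_deriv_right_le (f := f)
    (f' := fun u => deriv riemannZeta (u + I * t)) (δ := ‖f σ‖) (K := K) (ε := 0) (a := σ) (b := σ₀)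
    hcont (fun x _ => (hderiv x).hasDerivWithinAt) le_rfl
    (fun x hx => by rw [add_zero]; exact (hpt x hx.1).2)
  have hb := hG σ₀ (Set.right_mem_Icc.2 hσσ₀)
  rw [gronwallBound_ε0] at hb
  -- the exponent
  have hKexp : K * (σ₀ - σ) ≤ 2 * (2 * C₀ + 1) := by
    have h1 : σ₀ - σ ≤ 1 / L + 4 * cbar / L := by rw [hσ₀def]; linarith
    have h2 : K * (σ₀ - σ) ≤ K * (1 / L + 4 * cbar / L) := mul_le_mul_of_nonneg_left h1 hK0
    have h3 : K * (1 / L + 4 * cbar / L) = (2 * C₀ + 1) * (1 + 4 * cbar) := by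
      rw [hKdef]; field_simp
    rw [h3] at h2
    have h4 : (2 * C₀ + 1) * (1 + 4 * cbar) ≤ 2 * (2 * C₀ + 1) := by nlinarith
    linarith
  have hexp : Real.exp (K * (σ₀ - σ)) ≤ Real.exp (2 * (2 * C₀ + 1)) := Real.exp_le_exp.2 hKexp
  -- lower bound at `σ₀`
  have hσ₀re : ((σ₀ : ℂ) + I * t).re = σ₀ := by simp
  have hlow : 1 / (2 * L) ≤ ‖f σ₀‖ := by
    have h1 : 1 < ((σ₀ : ℂ) + I * t).re := by rw [hσ₀re, hσ₀def]; linarith [one_div_pos.2 hL0]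
    have h2 := norm_riemannZeta_ge_of_one_lt_re h1
    rw [hσ₀re] at h2
    have h3 : (σ₀ - 1) / σ₀ = 1 / (L + 1) := by
      rw [hσ₀def]; field_simp; ring
    rw [h3] at h2
    have h4 : 1 / (2 * L) ≤ 1 / (L + 1) := one_div_le_one_div_of_le (by linarith) (by linarith)
    exact h4.trans h2
  -- combine
  have hfσ : 0 < ‖f σ‖ := norm_pos_iff.2 (hpt σ le_rfl).1
  have hmain : 1 / (2 * L) ≤ ‖f σ‖ * Real.exp (2 * (2 * C₀ + 1)) :=
    hlow.trans (hb.trans (mul_le_mul_of_nonneg_left hexp hfσ.le))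
  have hE : 0 < Real.exp (2 * (2 * C₀ + 1)) := Real.exp_pos _
  show ‖(f σ)⁻¹‖ ≤ 2 * Real.exp (2 * (2 * C₀ + 1)) * L
  rw [norm_inv, inv_le_iff_one_le_mul₀ hfσ]
  rw [div_le_iff₀ (by positivity)] at hmain
  nlinarith

/-! ### Assembly: GPY (5.3)–(5.4) -/

/-- **Goldston–Pintz–Yıldırım (5.3)–(5.4)** ("By Theorem 3.11 and (3.11.8) in [T], there exists a
small constant `c̄ > 0`, for which we assume `c̄ ≤ 10⁻²`, such that `ζ(σ + it) ≠ 0` in the region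
`σ ≥ 1 − 4c̄/log(|t| + 3)` for all `t`. Furthermore, we have `ζ(σ+it) − 1/(σ−1+it) ≪ log(|t|+3)`,
`1/ζ(σ+it) ≪ log(|t|+3)`, `ζ'/ζ(σ+it) + 1/(σ−1+it) ≪ log(|t|+3)` in this region."), PROVED, with
one explicit implied constant `C` and the pole `s = 1` itself excluded (there the three left-hand
sides are meant by continuity; Lean's `riemannZeta 1` is a junk value). Inputs: the tree's
de la Vallée Poussin region and log-derivative bound for `ζ₁ = (s−1)ζ`
(`Literature.NumberTheory.LFunctions.classicalZFRData_riemannZeta`, Montgomery–Vaughan Theorems 6.6–6.7), Titchmarsh's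
Theorem 3.5 (`Literature.NumberTheory.LFunctions.ZetaOneLine.norm_riemannZeta_le_log`), the Dirichlet series of `ζ` and
`1/ζ = L(μ, s)` to the right of `1`, compactness near the pole, and Grönwall's inequality along
horizontal segments (Titchmarsh (3.11.6)–(3.11.8)).
[cite: GoldstonPintzYildirim2009, Section 5 eq. 5.3 and 5.4]
[cite: Titchmarsh1986, Theorem 3.11 eq. (3.11.7) and (3.11.8)] -/
theorem exists_zeroFreeRegion_bounds :
    ∃ cbar : ℝ, 0 < cbar ∧ cbar ≤ 1 / 100 ∧ ∃ C : ℝ, 0 < C ∧ ∀ s : ℂ, s ≠ 1 →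
      1 - 4 * cbar / Real.log (|s.im| + 3) ≤ s.re →
        riemannZeta s ≠ 0 ∧
        ‖riemannZeta s - 1 / (s - 1)‖ ≤ C * Real.log (|s.im| + 3) ∧
        ‖(riemannZeta s)⁻¹‖ ≤ C * Real.log (|s.im| + 3) ∧
        ‖deriv riemannZeta s / riemannZeta s + 1 / (s - 1)‖ ≤ C * Real.log (|s.im| + 3) := by
  obtain ⟨c₀, hc₀, C₀, hC₀, hreg0⟩ := Literature.NumberTheory.LFunctions.classicalZFRData_riemannZeta.norm_logDeriv_le
  have hreg : ∀ s : ℂ, 1 / 2 < s.re → 1 - c₀ / Real.log (|s.im| + 4) ≤ s.re →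
      riemannZeta₁ s ≠ 0 ∧ ‖deriv riemannZeta₁ s / riemannZeta₁ s‖ ≤ C₀ * Real.log (|s.im| + 4) :=
    fun s h1 h2 => hreg0 s (by linarith) h2
  set cbar : ℝ := min (c₀ / 8) (1 / 100) with hcbdef
  have hcb0 : 0 < cbar := lt_min (by positivity) (by norm_num)
  have hcb : cbar ≤ c₀ / 8 := min_le_left _ _
  have hcb1 : cbar ≤ 1 / 100 := min_le_right _ _
  obtain ⟨Ma, hMa0, hMa⟩ := exists_bound_sub_inv_rect
  obtain ⟨Mb, hMb0, hMb⟩ := exists_bound_inv_rect hreg hcb0.le hcb hcb1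
  set E : ℝ := 2 * Real.exp (2 * (2 * C₀ + 1)) with hEdef
  have hE0 : 0 < E := by positivity
  set C : ℝ := 22 + Ma + Mb + E + 2 * C₀ + 3 with hCdef
  have hl3 := MertensBound.one_lt_log_three
  refine ⟨cbar, hcb0, hcb1, C, by positivity, fun s hs1 hσ => ?_⟩
  have hL1 : 1 < Real.log (|s.im| + 3) := one_lt_log_abs_add_three s.im
  set L : ℝ := Real.log (|s.im| + 3) with hLdef
  obtain ⟨hζ, hc⟩ := ne_zero_and_norm_logDeriv_add_le hC₀ hreg hcb0.le hcb hcb1 hs1 hσ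
  refine ⟨hζ, ?_, ?_, ?_⟩
  · -- ζ − 1/(s−1)
    rcases le_or_gt 3 |s.im| with ht | ht
    · calc ‖riemannZeta s - 1 / (s - 1)‖ ≤ 22 * L := norm_sub_inv_le_of_three_le hcb1 ht hσ
        _ ≤ C * L := by apply mul_le_mul_of_nonneg_right _ (by linarith); rw [hCdef]; linarith
    · rcases le_or_gt s.re 2 with h2 | h2
      · have hhalf : 1 / 2 ≤ s.re := (region_dlvp hcb0.le hcb hcb1 hσ).2.le
        calc ‖riemannZeta s - 1 / (s - 1)‖ ≤ Ma := hMa s hhalf h2 ht.le hs1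
          _ ≤ C * L := by
              have : Ma ≤ C := by rw [hCdef]; linarith
              nlinarith
      · calc ‖riemannZeta s - 1 / (s - 1)‖ ≤ 3 := norm_sub_inv_le_of_two_lt_re h2
          _ ≤ C * L := by
              have : (3 : ℝ) ≤ C := by rw [hCdef]; linarith
              nlinarith
  · -- 1/ζ
    rcases le_or_gt (1 + 1 / L) s.re with h0 | h0
    · calc ‖(riemannZeta s)⁻¹‖ ≤ 1 + L := norm_inv_le_of_re_ge (by linarith) h0
        _ ≤ C * L := by
            have : (2 : ℝ) ≤ C := by rw [hCdef]; linarith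
            nlinarith
    · rcases le_or_gt 3 |s.im| with ht | ht
      · have hs : s = (s.re : ℂ) + I * s.im := by
          apply Complex.ext <;> simp
        have h := norm_inv_le_of_three_le hC₀ hreg hcb0.le hcb hcb1 ht hσ h0.le
        rw [← hs] at h
        calc ‖(riemannZeta s)⁻¹‖ ≤ E * L := h
          _ ≤ C * L := by
              apply mul_le_mul_of_nonneg_right _ (by linarith)
              rw [hCdef]; linarith
      · have h1 : 1 - 4 * cbar / Real.log 3 ≤ s.re := by
          have : 4 * cbar / L ≤ 4 * cbar / Real.log 3 :=
            div_le_div_of_nonneg_left (by linarith) (by linarith)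
              (Real.log_le_log (by norm_num) (by linarith [abs_nonneg s.im]))
          linarith
        have h2 : s.re ≤ 2 := by
          have : 1 / L ≤ 1 := by rw [div_le_one (by linarith)]; linarith
          linarith
        calc ‖(riemannZeta s)⁻¹‖ ≤ Mb := hMb s h1 h2 ht.le hs1
          _ ≤ C * L := by
              have : Mb ≤ C := by rw [hCdef]; linarith
              nlinarith
  · -- ζ'/ζ + 1/(s−1)
    calc _ ≤ 2 * C₀ * L := hc
      _ ≤ C * L := by
          apply mul_le_mul_of_nonneg_right _ (by linarith)
          rw [hCdef]; linarith

end Literature.NumberTheory.LFunctions.ZetaClassicalRegion
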